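import Summits.Ventures.DiscreteObjects.PP12.FlagTenOrbitDataOfPlane

/-!
# The `f = 10` flag-cell orbit data: equation (R3) at subtype level (kernel; Step D, conjunct 8 of `IsFlagTenOrbitMatrix` before transport)
Framing: lottery ticket; floor = certified bounds/negative ranges.

Cell pub-namedobj (venture DiscreteObjects), target (M), designs gen 13 (HOME FAMILY-FLAG7X §7b). Setting as in `FlagTenOrbitDataOfPlane`.
For two T-lines `b ∋ y`, `b' ∋ y'` through DIFFERENT fixed points `y ≠ y'` (`≠ c`; `b, b' ≠ l`):
`#{x ∈ u₀, x ≠ c : cOrb y x = orb3 b ∧ cOrb y' x = orb3 b'} + #{m fixed, m ≠ l : betaOrb m (orb3 b) = betaOrb m (orb3 b')} = 3`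
(**`tline_pair_count`**) — the plane-level identity `OrbitStructureOrderThree.flag_tlines_common_orbits` ('two T-lines share exactly three
non-trivial point orbits') with the common orbits sorted into exterior triangles (↔ vertices on `u₀`) and T-point orbits (↔ fixed lines `m ≠ l`).
This is conjunct 8, `#{i : C k i = t ∧ C k' i = t'} + #{j : β k j t = β k' j t'} = 3`, before transport. No `sorry`, no new axioms.
-/

namespace Summit.Ventures.DiscreteObjects.PP12

open Configuration Finset
open scoped Classical

namespace Collineation

variable {P L : Type*} [Membership P L] [ProjectivePlane P L] [Fintype P] [Fintype L] (σ : Collineation P L)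

section Flag

variable {l : L} {c : P} (hl : σ.onLines l = l) (hc : σ.onPoints c = c) (hcl : c ∈ l)
  (hP : ∀ p : P, σ.onPoints p = p → p ∈ l) (hL : ∀ m : L, σ.onLines m = m → c ∈ m)
  (h12 : ProjectivePlane.order P L = 12)

include hl hP in
/-- For an exterior `x` and a fixed point `y`: `cOrb y x = orb3 b` iff some point of the orbit of `x` lies on the T-line `b ∋ y`
(`σ³ = 1`; `b ≠ l`). -/
theorem cOrb_eq_iff (hq : σ.onPoints ^ 3 = 1) {x : P} (hxX : ∀ m : L, σ.onLines m = m → x ∉ m) {y : P} (hy : σ.onPoints y = y)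
    {b : L} (hyb : y ∈ b) :
    σ.cOrb l y x = orb3 σ.onLines b ↔ ∃ Q ∈ orb3 σ.onPoints x, Q ∈ b := by
  have hqL : σ.onLines ^ 3 = 1 := σ.onLines_pow_eq_one hq
  have hxf : σ.onPoints x ≠ x := σ.not_fixed_of_exterior_flag hl hP hxX
  have hxy : x ≠ y := fun e => hxf (by rw [e, hy])
  obtain ⟨hxk, hyk⟩ := lineThrough_spec l hxy
  have hyσ : ∀ e : L, y ∈ e → y ∈ σ.onLines e := fun e he => by have := σ.mem_map he; rwa [hy] at this
  change orb3 σ.onLines (lineThrough l x y) = orb3 σ.onLines b ↔ _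
  constructor
  · intro hC
    have hbk : b ∈ orb3 σ.onLines (lineThrough l x y) := by rw [hC]; exact self_mem_orb3 _ _
    rw [mem_orb3] at hbk
    rcases hbk with e | e | e
    · exact ⟨x, self_mem_orb3 _ _, by rw [e]; exact hxk⟩
    · exact ⟨σ.onPoints x, (mem_orb3 _ _ _).2 (Or.inr (Or.inl rfl)), by rw [e]; exact σ.mem_map hxk⟩
    · exact ⟨σ.onPoints (σ.onPoints x), (mem_orb3 _ _ _).2 (Or.inr (Or.inr rfl)), by rw [e]; exact σ.mem_map (σ.mem_map hxk)⟩
  · rintro ⟨Q, hQx, hQb⟩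
    have hQX := σ.exterior_of_mem_orb3 hxX hQx
    have hQf : σ.onPoints Q ≠ Q := σ.not_fixed_of_exterior_flag hl hP hQX
    have hQy : Q ≠ y := fun e => hQf (by rw [e, hy])
    have hk : ∀ k' : L, Q ∈ k' → y ∈ k' → k' = b := fun k' h1 h2 => (Nondegenerate.eq_or_eq h1 h2 hQb hyb).resolve_left hQy
    symm
    apply orb3_eq_of_mem σ.onLines hqL
    -- b ∈ orb3 (x·y): b is the image of x·y carrying Q
    have h3 := apply_three σ.onPoints hq x
    have h3L := apply_three σ.onLines hqL (lineThrough l x y)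
    rw [mem_orb3] at hQx ⊢
    rcases hQx with e | e | e
    · left; exact (hk _ (by rw [e]; exact hxk) hyk).symm
    · right; left; exact (hk _ (by rw [e]; exact σ.mem_map hxk) (hyσ _ hyk)).symm
    · right; right; exact (hk _ (by rw [e]; exact σ.mem_map (σ.mem_map hxk)) (hyσ _ (hyσ _ hyk))).symm

include hl hc hcl hP hL h12 in
/-- **(R3) at subtype level** (`f = 10`): see the module docstring. -/
theorem tline_pair_count (hq : σ.onPoints ^ 3 = 1) (hf : fixedCard σ.onPoints = 10) {u₀ : L} (hcu₀ : c ∈ u₀) (hu₀ : σ.onLines u₀ ≠ u₀)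
    {y y' : P} (hy : σ.onPoints y = y) (hyc : y ≠ c) (hy' : σ.onPoints y' = y') (hy'c : y' ≠ c) (hyy' : y ≠ y')
    {b b' : L} (hyb : y ∈ b) (hbl : b ≠ l) (hy'b' : y' ∈ b') (hb'l : b' ≠ l) :
    (univ.filter fun x : P => x ∈ u₀ ∧ x ≠ c ∧ σ.cOrb l y x = orb3 σ.onLines b ∧ σ.cOrb l y' x = orb3 σ.onLines b').card
      + (univ.filter fun m : L => σ.onLines m = m ∧ m ≠ l ∧
          σ.betaOrb c m (orb3 σ.onLines b) = σ.betaOrb c m (orb3 σ.onLines b')).card = 3 := by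
  have hqL : σ.onLines ^ 3 = 1 := σ.onLines_pow_eq_one hq
  -- the plane-level count
  have h3 := σ.flag_tlines_common_orbits hq hcl hP hL hy hy' hyy' hyc hy'c hyb hbl hy'b' hb'l
  set S : Finset P := univ.filter fun q : P => q ∈ b ∧ σ.onPoints q ≠ q ∧ ∃ q' ∈ orb3 σ.onPoints q, q' ∈ b' with hS
  rw [← h3, ← Finset.card_filter_add_card_filter_not (s := S) (fun q : P => ∀ m : L, σ.onLines m = m → q ∉ m)]
  have hcb : c ∉ b := σ.c_not_mem_tline hcl hP hy hyc hyb hbl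
  have hcb' : c ∉ b' := σ.c_not_mem_tline hcl hP hy' hy'c hy'b' hb'l
  have hb1 : ∀ q : P, ((orb3 σ.onPoints q).filter fun q' => q' ∈ b).card ≤ 1 := σ.tline_orbit_simple hcl hP hL hq hy hyc hyb hbl
  congr 1
  · -- exterior part ↔ vertices x with both orbit conditions
    set F : Finset P := univ.filter fun x : P => x ∈ u₀ ∧ x ≠ c ∧ σ.cOrb l y x = orb3 σ.onLines b ∧ σ.cOrb l y' x = orb3 σ.onLines b' with hF
    let Ψ : P → P := fun x => if h : ((orb3 σ.onPoints x).filter fun q => q ∈ b).Nonempty then h.choose else c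
    have memF : ∀ x ∈ F, (∀ m' : L, σ.onLines m' = m' → x ∉ m') ∧ x ∈ u₀ ∧ (∃ Q ∈ orb3 σ.onPoints x, Q ∈ b) ∧
        ∃ Q' ∈ orb3 σ.onPoints x, Q' ∈ b' := by
      intro x hx; rw [hF, mem_filter] at hx
      obtain ⟨-, hxu, hxc, hC, hC'⟩ := hx
      have hxX := σ.exterior_of_mem_cline hL hcu₀ hu₀ hxu hxc
      exact ⟨hxX, hxu, (σ.cOrb_eq_iff hl hP hq hxX hy hyb).1 hC, (σ.cOrb_eq_iff hl hP hq hxX hy' hy'b').1 hC'⟩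
    have hΨ : ∀ x ∈ F, Ψ x ∈ orb3 σ.onPoints x ∧ Ψ x ∈ b := by
      intro x hx
      obtain ⟨-, -, ⟨Q, hQ, hQb⟩, -⟩ := memF x hx
      have hne : ((orb3 σ.onPoints x).filter fun q => q ∈ b).Nonempty := ⟨Q, mem_filter.2 ⟨hQ, hQb⟩⟩
      have : Ψ x = hne.choose := by simp only [Ψ, dif_pos hne]
      rw [this]; exact mem_filter.1 hne.choose_spec
    refine Finset.card_bij (fun x _ => Ψ x) (fun x hx => ?_) (fun x₁ hx₁ x₂ hx₂ heq => ?_) (fun q hq' => ?_)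
    · -- Ψ x ∈ S ∩ exterior
      obtain ⟨hxX, -, -, ⟨Q', hQ', hQ'b'⟩⟩ := memF x hx
      obtain ⟨hΨo, hΨb⟩ := hΨ x hx
      have hΨX := σ.exterior_of_mem_orb3 hxX hΨo
      rw [mem_filter, hS, mem_filter]
      refine ⟨⟨mem_univ _, hΨb, σ.not_fixed_of_exterior_flag hl hP hΨX, Q', ?_, hQ'b'⟩, hΨX⟩
      rw [orb3_eq_of_mem σ.onPoints hq hΨo]; exact hQ'
    · -- injective: same orbit, one vertex on u₀
      obtain ⟨hΨo₁, -⟩ := hΨ x₁ hx₁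
      obtain ⟨hΨo₂, -⟩ := hΨ x₂ hx₂
      rw [← heq] at hΨo₂
      have horb : orb3 σ.onPoints x₂ = orb3 σ.onPoints x₁ := by
        rw [← orb3_eq_of_mem σ.onPoints hq hΨo₂, orb3_eq_of_mem σ.onPoints hq hΨo₁]
      have hx₂o : x₂ ∈ orb3 σ.onPoints x₁ := by rw [← horb]; exact self_mem_orb3 _ _
      have h₁u : x₁ ∈ u₀ := (mem_filter.1 hx₁).2.1
      have h₂u : x₂ ∈ u₀ := (mem_filter.1 hx₂).2.1
      have hle := σ.card_orb3_inter_cline_le_one hc hq hcu₀ hu₀ x₁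
      by_contra hne
      have h2 : 2 ≤ ((orb3 σ.onPoints x₁).filter fun q => q ∈ u₀).card := by
        have hsub : ({x₁, x₂} : Finset P) ⊆ (orb3 σ.onPoints x₁).filter fun q => q ∈ u₀ := by
          intro z hz; rw [mem_insert, mem_singleton] at hz; rw [mem_filter]
          rcases hz with rfl | rfl
          · exact ⟨self_mem_orb3 _ _, h₁u⟩
          · exact ⟨hx₂o, h₂u⟩
        have := card_le_card hsub; rwa [card_pair hne] at this
      omega
    · -- surjective
      rw [mem_filter, hS, mem_filter] at hq'
      obtain ⟨⟨-, hqb, -, Q', hQ'q, hQ'b'⟩, hqX⟩ := hq'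
      obtain ⟨x, hxq, hxu⟩ := σ.exterior_orbit_meets_cline hl hc hcl hL h12 hq hf hcu₀ hu₀ hqX
      have hxX := σ.exterior_of_mem_orb3 hqX hxq
      have hxc : x ≠ c := fun e => hxX l hl (e ▸ hcl)
      have hox : orb3 σ.onPoints x = orb3 σ.onPoints q := orb3_eq_of_mem σ.onPoints hq hxq
      have hqo : q ∈ orb3 σ.onPoints x := by rw [hox]; exact self_mem_orb3 _ _
      have hQ'o : Q' ∈ orb3 σ.onPoints x := by rw [hox]; exact hQ'q
      have hxF : x ∈ F := by
        rw [hF, mem_filter]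
        exact ⟨mem_univ _, hxu, hxc, (σ.cOrb_eq_iff hl hP hq hxX hy hyb).2 ⟨q, hqo, hqb⟩,
          (σ.cOrb_eq_iff hl hP hq hxX hy' hy'b').2 ⟨Q', hQ'o, hQ'b'⟩⟩
      refine ⟨x, hxF, ?_⟩
      obtain ⟨hΨo, hΨb⟩ := hΨ x hxF
      by_contra hne
      have h2 : 2 ≤ ((orb3 σ.onPoints x).filter fun q' => q' ∈ b).card := by
        have hsub : ({Ψ x, q} : Finset P) ⊆ (orb3 σ.onPoints x).filter fun q' => q' ∈ b := by
          intro z hz; rw [mem_insert, mem_singleton] at hz; rw [mem_filter]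
          rcases hz with rfl | rfl
          · exact ⟨hΨo, hΨb⟩
          · exact ⟨hqo, hqb⟩
        have := card_le_card hsub; rwa [card_pair hne] at this
      have := hb1 x; omega
  · -- T-point part ↔ fixed lines m ≠ l with equal β
    set G : Finset L := univ.filter fun m : L => σ.onLines m = m ∧ m ≠ l ∧
        σ.betaOrb c m (orb3 σ.onLines b) = σ.betaOrb c m (orb3 σ.onLines b') with hG
    refine Finset.card_bij (fun m _ => meetPt c b m) (fun m hm => ?_) (fun m₁ hm₁ m₂ hm₂ heq => ?_) (fun q hq' => ?_)
    · rw [hG, mem_filter] at hm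
      obtain ⟨-, hm, hml, hβ⟩ := hm
      obtain ⟨w, hwb, hwm, hwf, hwc, huniq⟩ := σ.tline_inter_fixedLine hcl hP hL hy hyc hyb hbl hm hml
      have hbm : b ≠ m := fun e => hcb (e ▸ hL m hm)
      have hb'm : b' ≠ m := fun e => hcb' (e ▸ hL m hm)
      have hw : meetPt c b m = w := huniq _ (meetPt_spec c hbm).1 (meetPt_spec c hbm).2
      rw [σ.betaOrb_eq hc hL hq hm hcb (self_mem_orb3 _ _), σ.betaOrb_eq hc hL hq hm hcb' (self_mem_orb3 _ _)] at hβ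
      rw [mem_filter, hS, mem_filter, hw]
      refine ⟨⟨mem_univ _, hwb, hwf, meetPt c b' m, ?_, (meetPt_spec c hb'm).1⟩, fun h => h m hm hwm⟩
      rw [← hw, hβ]; exact self_mem_orb3 _ _
    · -- injective: two fixed lines through the non-c point meetPt coincide
      rw [hG, mem_filter] at hm₁ hm₂
      have hbm₁ : b ≠ m₁ := fun e => hcb (e ▸ hL m₁ hm₁.2.1)
      have hbm₂ : b ≠ m₂ := fun e => hcb (e ▸ hL m₂ hm₂.2.1)
      obtain ⟨w, -, hwm, -, hwc, huniq⟩ := σ.tline_inter_fixedLine hcl hP hL hy hyc hyb hbl hm₁.2.1 hm₁.2.2.1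
      have h1 : meetPt c b m₁ = w := huniq _ (meetPt_spec c hbm₁).1 (meetPt_spec c hbm₁).2
      have h2 : meetPt c b m₂ ∈ m₂ := (meetPt_spec c hbm₂).2
      rw [← heq, h1] at h2
      exact (Nondegenerate.eq_or_eq hwm (hL m₁ hm₁.2.1) h2 (hL m₂ hm₂.2.1)).resolve_left hwc
    · -- surjective: a non-exterior non-fixed point of b lies on a fixed line m ≠ l
      rw [mem_filter, hS, mem_filter] at hq'
      obtain ⟨⟨-, hqb, hqf, q', hq'q, hq'b'⟩, hqX⟩ := hq'
      push Not at hqX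
      obtain ⟨m, hm, hqm⟩ := hqX
      have hml : m ≠ l := by
        intro e; rw [e] at hqm
        have hqy : q = y := σ.tline_inter_l hP hy hyb hbl hqb hqm
        exact hqf (by rw [hqy, hy])
      have hbm : b ≠ m := fun e => hcb (e ▸ hL m hm)
      have hb'm : b' ≠ m := fun e => hcb' (e ▸ hL m hm)
      have hqw : q = meetPt c b m := meetPt_eq c hbm hqb hqm
      -- q' ∈ orb3 q lies on m (m fixed) and on b', so it is meetPt c b' m
      have hq'm : q' ∈ m := by
        rw [mem_orb3] at hq'q
        rcases hq'q with e | e | e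
        · rw [e]; exact hqm
        · rw [e]; exact (σ.mem_fixedLine_iff hm _).2 hqm
        · rw [e]; exact (σ.mem_fixedLine_iff hm _).2 ((σ.mem_fixedLine_iff hm _).2 hqm)
      have hq'w : q' = meetPt c b' m := meetPt_eq c hb'm hq'b' hq'm
      refine ⟨m, ?_, hqw.symm⟩
      rw [hG, mem_filter]
      refine ⟨mem_univ _, hm, hml, ?_⟩
      rw [σ.betaOrb_eq hc hL hq hm hcb (self_mem_orb3 _ _), σ.betaOrb_eq hc hL hq hm hcb' (self_mem_orb3 _ _), ← hqw, ← hq'w]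
      exact (orb3_eq_of_mem σ.onPoints hq hq'q).symm

end Flag

end Collineation

end Summit.Ventures.DiscreteObjects.PP12
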